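import Summits.Ventures.HSemireg.Pad4TowerUniverseDT1

/-!
# Venture HSemireg — PAD-4: a kernel CHECKER for RULE-D greatest-fixpoint certificates on (F1ℝ) universes
# (shape-level deletion certificates ⇒ every RULE-D-closed support lies in the surviving shapes M*)

HONEST FRAMING. Lean index of the computation cell `pub-hsemireg` (S4-PUSH, H2 door PAD-4); seat `hodge-semireg-assembly-p1`
(director-hodge g7 WIDTH-LEVER W2 on stmt-HodgeConjecture-18881: «assembly from typed lemmas»). The cell closes a letter
UNIVERSE U (all two-level classes over a finite alphabet) in two moves: (1) the GREATEST RULE-D-CLOSED orbit-union M*(U) —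
every RULE-D-closed support inside U lies in M*(U), because RULE D is monotone in the support (bc5-plan g3 memo §13 (F)(G),
tool `hodge-bloch-bc5-plan/work/ruleD_universe2.py`, greatest fixpoint by deletion rounds); (2) LEMMA Ψ₁ ∕ kills on M*(U). This
file is the KERNEL CHECKER for move (1) on the (F1ℝ) light-cone alphabet of `Pad4TowerLemmaT` (`Cell`, `Config`, `RuleDN`,
`RuleDP`, `RuleDClosed` — the (r2a) clause included) with shapes = keys of `Pad4TowerUniverseDT1` (`Cell.key`, the multiset of
normalised letters): a universe's deletion rounds are given as DATA (per leaving shape a SHAPE-LEVEL CERTIFICATE: two letter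
coordinates on different factors with unequal values all of whose lowerings — legs and (r2a) covers — resp. raisings up to the
alphabet bound fall outside the current admissible shapes of the other level), the checker `roundsOK` validates them by
`decide`, and `rounds_sound` PROVES that every RULE-D-closed configuration inside the universe has all its shapes among the
survivors. Instances: `Pad4TowerUniverseU5` (U5, 5 rounds, M* = 14 N + 8 P shapes = the census entry's 25 orbits), U6 (next file).

CONTENT. §1 keys under one- and two-coordinate changes (`key_of_agree_off`, `key_of_agree_off₂`: the key of a leg ∕ server ∕
cover of `Z` is `Z`'s key with one or two letters replaced). §2 `ShapeCert`; an integer code `kenc` of a shape (membership tests of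
the checker run on codes — soundness uses only `K ∈ L → kenc K ∈ L.map kenc`); `NValid` (lowerings have non-admissible codes),
`PValid` (raisings `≤ B` have non-admissible codes), `CoordBounded`; soundness `not_ruleDN_of_cert` ∕ `not_ruleDP_of_cert` (a valid
certificate for the shape of a cell refutes RULE D at that cell whenever the other level's shape codes are admissible). §3 rounds on
code lists: `codesAfter`, the checker `roundsOK`, the survivors `finalN` ∕ `finalP`, `CertsInj` (the certificates' shapes decode
uniquely inside the universe — checked per instance; the one place injectivity of the coding is needed) and `rounds_sound`
(induction on the rounds: a closed configuration inside round `k`'s lists is inside round `k+1`'s). §4 `keysOver` (all shapes over an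
alphabet), `key_eq_quad`, the structural completeness `key_mem_keysOver`, `coordBounded_of_letters`, `key_mem_of_code`.

WHAT IS NOT HERE. The (H2)∕(E1) meaning of RULE D (the diagonal first-order criterion, PAD4-BALANCED §1′ — pencil, as in
`Pad4TowerLemmaT`); μ₄ phases (RULE D(μ₄) of bc5-plan's tool is the same clause combinatorics with four null directions per
factor — the cross-check of record is bc5-plan's 1 222 ∕ 1 222 agreement with s4's (F1ℝ) rule, memo §13 (D)); THEOREM FC1; any
(H1)-LP. Nothing is a statement about a variety, a sheaf, σ, a seed or an abelian variety; NOTHING HERE SAYS THAT HC ∕ HC_CM ∕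
HC_AV ∕ W₆ ∕ HC_Kum4Type HOLDS OR FAILS. No `instance`, no notation, no named fact, 0 `sorry`; axioms standard (the certificate
predicates are `abbrev`s, so `decide` finds their decidability by unfolding, as for `Pad4TowerLemmaT`'s predicates).

SOURCES (sha16): BC5-PLAN-g3-MEMO.md v2.9 098dac25a88548d7 §13 (F)(G) (RULE-D greatest models, `ruleD_universe2.py`,
validation 1 222∕1 222 vs s4's `ruled_sat_q1.py`); PAD4-BALANCED-search-1.md v1.6 e2d93ac598b3704c §1′ (RULE D); census words U5
ae495ae0f06092b8; `Pad4TowerLemmaT.lean` bfb2cc0a1a90b649 (RULE D as typed); `Pad4TowerUniverseDT1.lean` (keys).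
-/

namespace Summit.Ventures.HSemireg.Pad4Tower

open Finset

/-! ## §1 Keys under one- and two-coordinate changes -/

/-- the normalised letter of the light-cone pair `(a, b)`: `(max, min)`. -/
def nrm (a b : ℕ) : ℕ × ℕ := (max a b, min a b)

/-- the letter of `Z` on `f`, read from side `s` first. -/
theorem nl_eq_nrm (Z : Cell) (f : Fin 4) (s : Fin 2) : nl Z f = nrm (Z f s) (Z f s.rev) := by
  fin_cases s
  · rfl
  · simp [nl, nrm, max_comm, min_comm]

/-- the key with the letter of factor `f` removed is the multiset of the other three letters. -/
theorem key_erase (Z : Cell) (f : Fin 4) : Z.key.erase (nl Z f) = ((univ : Finset (Fin 4)).val.erase f).map (nl Z) := by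
  unfold Cell.key
  conv_lhs => rw [← Multiset.cons_erase (Finset.mem_univ_val f), Multiset.map_cons]
  rw [Multiset.erase_cons_head]

/-- a letter of `Z.key.erase (nl Z f)` sits on a factor other than `f`. -/
theorem exists_ne_of_mem_erase {Z : Cell} {f : Fin 4} {y : ℕ × ℕ} (h : y ∈ Z.key.erase (nl Z f)) :
    ∃ g, g ≠ f ∧ nl Z g = y := by
  rw [key_erase] at h
  obtain ⟨g, hg, hgy⟩ := Multiset.mem_map.1 h
  exact ⟨g, ((Multiset.Nodup.mem_erase_iff Finset.univ.nodup).1 hg).1, hgy⟩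

/-- **key of a cell that agrees with `Z` off the factor `f`.** -/
theorem key_of_agree_off {P Z : Cell} {f : Fin 4} (h : ∀ g, g ≠ f → nl P g = nl Z g) :
    P.key = nl P f ::ₘ Z.key.erase (nl Z f) := by
  rw [key_erase]
  have h1 : P.key = (f ::ₘ (univ : Finset (Fin 4)).val.erase f).map (nl P) := by
    rw [Multiset.cons_erase (Finset.mem_univ_val f)]; rfl
  rw [h1, Multiset.map_cons]
  congr 1
  exact Multiset.map_congr rfl fun g hg => h g ((Multiset.Nodup.mem_erase_iff Finset.univ.nodup).1 hg).1

/-- **key of a cell that agrees with `Z` off two factors `f ≠ g`.** -/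
theorem key_of_agree_off₂ {P Z : Cell} {f g : Fin 4} (hfg : f ≠ g) (h : ∀ h', h' ≠ f → h' ≠ g → nl P h' = nl Z h') :
    P.key = nl P f ::ₘ nl P g ::ₘ (Z.key.erase (nl Z f)).erase (nl Z g) := by
  have hg : g ∈ ((univ : Finset (Fin 4)).val.erase f) :=
    (Multiset.Nodup.mem_erase_iff Finset.univ.nodup).2 ⟨hfg.symm, Finset.mem_univ_val g⟩
  have hZ : (Z.key.erase (nl Z f)).erase (nl Z g) = (((univ : Finset (Fin 4)).val.erase f).erase g).map (nl Z) := by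
    rw [key_erase]
    conv_lhs => rw [← Multiset.cons_erase hg, Multiset.map_cons]
    rw [Multiset.erase_cons_head]
  have hP : P.key = nl P f ::ₘ nl P g ::ₘ (((univ : Finset (Fin 4)).val.erase f).erase g).map (nl P) := by
    have : P.key = (f ::ₘ g ::ₘ ((univ : Finset (Fin 4)).val.erase f).erase g).map (nl P) := by
      rw [Multiset.cons_erase hg, Multiset.cons_erase (Finset.mem_univ_val f)]; rfl
    rw [this, Multiset.map_cons, Multiset.map_cons]
  rw [hP, hZ]
  congr 2
  refine Multiset.map_congr rfl fun h' hh' => ?_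
  have h1 := (Multiset.Nodup.mem_erase_iff (Multiset.Nodup.erase f Finset.univ.nodup)).1 hh'
  have h2 := (Multiset.Nodup.mem_erase_iff Finset.univ.nodup).1 h1.2
  exact h h' h2.1 h1.1

/-! ## §2 Shape-level RULE-D failure certificates -/

/-- the coordinate of the letter `x = (max, min)` in the role `u` (`true` = the larger coordinate). -/
def lval (x : ℕ × ℕ) (u : Bool) : ℕ := if u then x.1 else x.2
/-- the other coordinate. -/
def loth (x : ℕ × ℕ) (u : Bool) : ℕ := if u then x.2 else x.1

/-- a factor carrying the letter `x` has a side realising the role `u`: value `lval x u` there, `loth x u` on the other side. -/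
theorem exists_side {Z : Cell} {f : Fin 4} {x : ℕ × ℕ} (h : nl Z f = x) (u : Bool) :
    ∃ s : Fin 2, Z f s = lval x u ∧ Z f s.rev = loth x u := by
  subst h
  unfold nl lval loth
  rcases le_total (Z f 0) (Z f 1) with hle | hle
  · cases u
    · exact ⟨0, by simp [min_eq_left hle, max_eq_right hle]⟩
    · exact ⟨1, by simp [min_eq_left hle, max_eq_right hle]⟩
  · cases u
    · exact ⟨1, by simp [min_eq_right hle, max_eq_left hle]⟩
    · exact ⟨0, by simp [min_eq_right hle, max_eq_left hle]⟩

/-- a SHAPE-LEVEL CERTIFICATE: a shape (key) `K` and two letter-coordinates `(x, u)`, `(y, v)` of it. -/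
structure ShapeCert where
  /-- the shape (multiset of normalised letters). -/
  K : Multiset (ℕ × ℕ)
  /-- first letter. -/
  x : ℕ × ℕ
  /-- role of the first coordinate (`true` = the larger one). -/
  u : Bool
  /-- second letter (on another factor). -/
  y : ℕ × ℕ
  /-- role of the second coordinate. -/
  v : Bool

/-- an INTEGER CODE of a shape, used only to make the membership tests of the checker cheap (`Σ_x 8^(T(max)+min)`, `T` triangular;
injective on four-letter shapes, but soundness below needs no injectivity — only `K ∈ L → kenc K ∈ L.map kenc`; where a code
has to be decoded (`rounds_sound`), injectivity on the finite universe is CHECKED, `CertsInj`). -/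
def kenc (K : Multiset (ℕ × ℕ)) : ℕ := (K.map fun x => 8 ^ (x.1 * (x.1 + 1) / 2 + x.2)).sum

/-- **N-side certificate** against the codes `PKe` of the admissible `P`-shapes: the two coordinates lie on different factors, carry
different values, and EVERY lowering of the first, of the second, or of both ((r1) legs and (r2a) covers below) produces a shape
whose code is not admissible — so RULE D fails at every `N`-cell of shape `K` whose `P`-partners all have admissible shapes. -/
abbrev ShapeCert.NValid (PKe : List ℕ) (c : ShapeCert) : Prop :=
  c.x ∈ c.K ∧ c.y ∈ c.K.erase c.x ∧ lval c.x c.u ≠ lval c.y c.v ∧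
    (∀ d < lval c.x c.u, kenc (nrm d (loth c.x c.u) ::ₘ c.K.erase c.x) ∉ PKe) ∧
    (∀ e < lval c.y c.v, kenc (nrm e (loth c.y c.v) ::ₘ c.K.erase c.y) ∉ PKe) ∧
    (∀ d < lval c.x c.u, ∀ e < lval c.y c.v,
      kenc (nrm d (loth c.x c.u) ::ₘ nrm e (loth c.y c.v) ::ₘ (c.K.erase c.x).erase c.y) ∉ PKe)

/-- **P-side certificate** against the codes `NKe` of the admissible `N`-shapes, for cells with coordinates `≤ B`: every RAISING of
the first coordinate, of the second, or of both (to values `≤ B`) produces a shape whose code is not admissible. -/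
abbrev ShapeCert.PValid (NKe : List ℕ) (B : ℕ) (c : ShapeCert) : Prop :=
  c.x ∈ c.K ∧ c.y ∈ c.K.erase c.x ∧ lval c.x c.u ≠ lval c.y c.v ∧
    (∀ d < B + 1, lval c.x c.u < d → kenc (nrm d (loth c.x c.u) ::ₘ c.K.erase c.x) ∉ NKe) ∧
    (∀ e < B + 1, lval c.y c.v < e → kenc (nrm e (loth c.y c.v) ::ₘ c.K.erase c.y) ∉ NKe) ∧
    (∀ d < B + 1, lval c.x c.u < d → ∀ e < B + 1, lval c.y c.v < e →
      kenc (nrm d (loth c.x c.u) ::ₘ nrm e (loth c.y c.v) ::ₘ (c.K.erase c.x).erase c.y) ∉ NKe)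

/-- cells with all light-cone coordinates `≤ B`. -/
abbrev CoordBounded (B : ℕ) (Z : Cell) : Prop := ∀ f s, Z f s ≤ B

/-- **soundness, N side**: a valid N-certificate for the shape of `Z` refutes RULE D at `Z` in every configuration whose
`P`-cells have admissible shape codes. -/
theorem not_ruleDN_of_cert {C : Config} {PKe : List ℕ} (hP : ∀ P ∈ C.upper, kenc P.key ∈ PKe) {Z : Cell}
    {c : ShapeCert} (hK : Z.key = c.K) (hc : c.NValid PKe) : ¬ RuleDN C Z := by
  obtain ⟨hx, hy, hne, h1, h2, h3⟩ := hc
  rw [← hK] at hx hy h1 h2 h3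
  obtain ⟨f, hf⟩ := exists_of_mem_key hx
  rw [← hf] at hy
  obtain ⟨g, hgf, hg⟩ := exists_ne_of_mem_erase hy
  obtain ⟨s, hs, hs'⟩ := exists_side hf c.u
  obtain ⟨r, hr, hr'⟩ := exists_side hg c.v
  intro hD
  rcases hD f g (Ne.symm hgf) s r (by rw [hs, hr]; exact hne) with ⟨P, hPu, hag, hlt⟩ | ⟨P, hPu, hag, hlt⟩ |
      ⟨P, hPu, hag, hlt, hlt'⟩
  · refine h1 (P f s) (hs ▸ hlt) ?_
    have hkey := key_of_agree_off (P := P) (Z := Z) (f := f) fun g' hg' => by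
      unfold nl; rw [hag g' 0 (fun h => hg' h.1), hag g' 1 (fun h => hg' h.1)]
    rw [nl_eq_nrm P f s, hag f s.rev (fun h => absurd h.2 (by fin_cases s <;> decide)), hs', hf] at hkey
    exact hkey ▸ hP P hPu
  · refine h2 (P g r) (hr ▸ hlt) ?_
    have hkey := key_of_agree_off (P := P) (Z := Z) (f := g) fun g' hg' => by
      unfold nl; rw [hag g' 0 (fun h => hg' h.1), hag g' 1 (fun h => hg' h.1)]
    rw [nl_eq_nrm P g r, hag g r.rev (fun h => absurd h.2 (by fin_cases r <;> decide)), hr', hg] at hkey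
    exact hkey ▸ hP P hPu
  · refine h3 (P f s) (hs ▸ hlt) (P g r) (hr ▸ hlt') ?_
    have hkey := key_of_agree_off₂ (P := P) (Z := Z) (Ne.symm hgf) fun h' h1' h2' => by
      unfold nl; rw [hag h' 0 (fun h => h1' h.1) (fun h => h2' h.1), hag h' 1 (fun h => h1' h.1) (fun h => h2' h.1)]
    rw [nl_eq_nrm P f s, nl_eq_nrm P g r, hag f s.rev (fun h => absurd h.2 (by fin_cases s <;> decide))
      (fun h => hgf h.1.symm), hag g r.rev (fun h => hgf h.1) (fun h => absurd h.2 (by fin_cases r <;> decide)),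
      hs', hr', hf, hg] at hkey
    exact hkey ▸ hP P hPu

/-- **soundness, P side**: a valid P-certificate for the shape of `P` refutes RULE D at `P` in every configuration whose `N`-cells
are `B`-bounded with admissible shape codes. -/
theorem not_ruleDP_of_cert {C : Config} {NKe : List ℕ} {B : ℕ} (hB : ∀ N ∈ C.lower, CoordBounded B N)
    (hN : ∀ N ∈ C.lower, kenc N.key ∈ NKe) {P : Cell} {c : ShapeCert} (hK : P.key = c.K) (hc : c.PValid NKe B) :
    ¬ RuleDP C P := by
  obtain ⟨hx, hy, hne, h1, h2, h3⟩ := hc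
  rw [← hK] at hx hy h1 h2 h3
  obtain ⟨f, hf⟩ := exists_of_mem_key hx
  rw [← hf] at hy
  obtain ⟨g, hgf, hg⟩ := exists_ne_of_mem_erase hy
  obtain ⟨s, hs, hs'⟩ := exists_side hf c.u
  obtain ⟨r, hr, hr'⟩ := exists_side hg c.v
  intro hD
  rcases hD f g (Ne.symm hgf) s r (by rw [hs, hr]; exact hne) with ⟨N, hNl, hag, hlt⟩ | ⟨N, hNl, hag, hlt⟩ |
      ⟨N, hNl, hag, hlt, hlt'⟩
  · refine h1 (N f s) (Nat.lt_succ_of_le (hB N hNl f s)) (hs ▸ hlt) ?_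
    have hkey := key_of_agree_off (P := N) (Z := P) (f := f) fun g' hg' => by
      unfold nl; rw [hag g' 0 (fun h => hg' h.1), hag g' 1 (fun h => hg' h.1)]
    rw [nl_eq_nrm N f s, hag f s.rev (fun h => absurd h.2 (by fin_cases s <;> decide)), hs', hf] at hkey
    exact hkey ▸ hN N hNl
  · refine h2 (N g r) (Nat.lt_succ_of_le (hB N hNl g r)) (hr ▸ hlt) ?_
    have hkey := key_of_agree_off (P := N) (Z := P) (f := g) fun g' hg' => by
      unfold nl; rw [hag g' 0 (fun h => hg' h.1), hag g' 1 (fun h => hg' h.1)]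
    rw [nl_eq_nrm N g r, hag g r.rev (fun h => absurd h.2 (by fin_cases r <;> decide)), hr', hg] at hkey
    exact hkey ▸ hN N hNl
  · refine h3 (N f s) (Nat.lt_succ_of_le (hB N hNl f s)) (hs ▸ hlt) (N g r) (Nat.lt_succ_of_le (hB N hNl g r))
      (hr ▸ hlt') ?_
    have hkey := key_of_agree_off₂ (P := N) (Z := P) (Ne.symm hgf) fun h' h1' h2' => by
      unfold nl; rw [hag h' 0 (fun h => h1' h.1) (fun h => h2' h.1), hag h' 1 (fun h => h1' h.1) (fun h => h2' h.1)]
    rw [nl_eq_nrm N f s, nl_eq_nrm N g r, hag f s.rev (fun h => absurd h.2 (by fin_cases s <;> decide))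
      (fun h => hgf h.1.symm), hag g r.rev (fun h => hgf h.1) (fun h => absurd h.2 (by fin_cases r <;> decide)),
      hs', hr', hf, hg] at hkey
    exact hkey ▸ hN N hNl

/-! ## §3 Deletion rounds: the greatest-fixpoint certificate and its soundness -/

/-- one deletion round: the `N`-shapes and the `P`-shapes that leave, each with its certificate. -/
abbrev Round := List ShapeCert × List ShapeCert

/-- the admissible codes of `L` that survive the deletions `del`. -/
def codesAfter (L : List ℕ) (del : List ShapeCert) : List ℕ := L.filter fun n => n ∉ del.map fun c => kenc c.K

set_option synthInstance.maxSize 4096 in -- the certificate predicates unfold to long decidable conjunctions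
/-- **the certificate checker** (on shape CODES): round by round, every leaving `N`-shape carries a valid N-certificate against
the CURRENT admissible `P`-codes and every leaving `P`-shape a valid P-certificate against the current `N`-codes (bound `B`); then
both code lists shrink. -/
def roundsOK (B : ℕ) : List ℕ → List ℕ → List Round → Bool
  | _, _, [] => true
  | NKe, PKe, (dN, dP) :: rest =>
    (dN.all fun c => decide (c.NValid PKe)) && (dP.all fun c => decide (c.PValid NKe B)) &&
      roundsOK B (codesAfter NKe dN) (codesAfter PKe dP) rest

/-- the `N`-codes surviving all rounds. -/
def finalN : List ℕ → List ℕ → List Round → List ℕ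
  | NKe, _, [] => NKe
  | NKe, PKe, (dN, dP) :: rest => finalN (codesAfter NKe dN) (codesAfter PKe dP) rest

/-- the `P`-codes surviving all rounds. -/
def finalP : List ℕ → List ℕ → List Round → List ℕ
  | _, PKe, [] => PKe
  | NKe, PKe, (dN, dP) :: rest => finalP (codesAfter NKe dN) (codesAfter PKe dP) rest

/-- the codes of the certificates' shapes DECODE uniquely inside the universe `U` (checked per instance by `decide`; this is where
the integer coding has to be injective, and only there). -/
abbrev CertsInj (U : List (Multiset (ℕ × ℕ))) (rs : List Round) : Prop :=
  ∀ r ∈ rs, ∀ c ∈ r.1 ++ r.2, ∀ K ∈ U, kenc K = kenc c.K → K = c.K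

/-- **SOUNDNESS OF THE GREATEST-FIXPOINT CERTIFICATE.** If the rounds check out from the code lists `(NKe, PKe)`, then every
RULE-D-closed configuration whose cells have shapes in the universe `U` (where the certificates decode uniquely), coordinates `≤ B`,
`N`-codes in `NKe` and `P`-codes in `PKe`, has all its shape codes among the survivors: a cell whose shape leaves at some round would
violate RULE D there (its partners ∕ servers ∕ covers would need shapes already gone), contradicting closedness. This is the kernel
form of «every RULE-D-closed support inside the universe lies in the greatest RULE-D-closed orbit-union M*» (bc5-plan g3 memo §13 (G),
`ruleD_universe2.py`), for (F1ℝ) cells and the RULE D of `Pad4TowerLemmaT` (with its (r2a) clause). -/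
theorem rounds_sound {C : Config} (hC : RuleDClosed C) {B : ℕ} {U : List (Multiset (ℕ × ℕ))}
    (hUN : ∀ Z ∈ C.lower, Z.key ∈ U) (hUP : ∀ P ∈ C.upper, P.key ∈ U) (hB : ∀ N ∈ C.lower, CoordBounded B N) :
    ∀ (rs : List Round) (NKe PKe : List ℕ), CertsInj U rs → roundsOK B NKe PKe rs = true →
      (∀ Z ∈ C.lower, kenc Z.key ∈ NKe) → (∀ P ∈ C.upper, kenc P.key ∈ PKe) →
      (∀ Z ∈ C.lower, kenc Z.key ∈ finalN NKe PKe rs) ∧ (∀ P ∈ C.upper, kenc P.key ∈ finalP NKe PKe rs)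
  | [], _, _, _, _, hN, hP => ⟨hN, hP⟩
  | (dN, dP) :: rest, NKe, PKe, hinj, hok, hN, hP => by
    simp only [roundsOK, Bool.and_eq_true, List.all_eq_true, decide_eq_true_eq] at hok
    obtain ⟨⟨hokN, hokP⟩, hrest⟩ := hok
    have hinj0 := hinj (dN, dP) (by simp)
    have hN' : ∀ Z ∈ C.lower, kenc Z.key ∈ codesAfter NKe dN := fun Z hZ => by
      refine List.mem_filter.2 ⟨hN Z hZ, decide_eq_true fun hmem => ?_⟩
      obtain ⟨c, hc, hcK⟩ := List.mem_map.1 hmem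
      exact not_ruleDN_of_cert hP (hinj0 c (List.mem_append_left _ hc) _ (hUN Z hZ) hcK.symm) (hokN c hc) (hC.1 Z hZ)
    have hP' : ∀ P ∈ C.upper, kenc P.key ∈ codesAfter PKe dP := fun P hPu => by
      refine List.mem_filter.2 ⟨hP P hPu, decide_eq_true fun hmem => ?_⟩
      obtain ⟨c, hc, hcK⟩ := List.mem_map.1 hmem
      exact not_ruleDP_of_cert hB hN (hinj0 c (List.mem_append_right _ hc) _ (hUP P hPu) hcK.symm) (hokP c hc) (hC.2 P hPu)
    exact rounds_sound hC hUN hUP hB rest _ _ (fun r hr => hinj r (List.mem_cons_of_mem _ hr)) hrest hN' hP'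

/-! ## §4 Universes given by a letter alphabet -/

/-- all shapes (multisets of four letters) over an alphabet `L`, each once (indices `i ≤ j ≤ k ≤ l`). -/
def keysOver (L : List (ℕ × ℕ)) : List (Multiset (ℕ × ℕ)) :=
  (List.range L.length).flatMap fun i => (List.range L.length).flatMap fun j =>
    (List.range L.length).flatMap fun k => (List.range L.length).flatMap fun l =>
      if i ≤ j ∧ j ≤ k ∧ k ≤ l then [{L.getD i (0, 0), L.getD j (0, 0), L.getD k (0, 0), L.getD l (0, 0)}] else []

/-- the key of a cell as the multiset of its four letters listed factor by factor. -/
theorem key_eq_quad (Z : Cell) : Z.key = {nl Z 0, nl Z 1, nl Z 2, nl Z 3} := by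
  unfold Cell.key
  rw [Fin.univ_val_map]
  simp [List.ofFn_succ]
  rfl

/-- **completeness of `keysOver`**: a cell whose four letters lie in the alphabet `L` has its key listed. -/
theorem key_mem_keysOver {L : List (ℕ × ℕ)} {Z : Cell} (h : ∀ f, nl Z f ∈ L) : Z.key ∈ keysOver L := by
  have hidx : ∀ f, ∃ a, a < L.length ∧ L.getD a (0, 0) = nl Z f := fun f => by
    obtain ⟨a, ha, hget⟩ := List.getElem_of_mem (h f)
    exact ⟨a, ha, by rw [List.getD_eq_getElem?_getD, List.getElem?_eq_getElem ha, Option.getD_some, hget]⟩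
  choose a ha hget using hidx
  set M : Multiset ℕ := {a 0, a 1, a 2, a 3} with hM
  have hkey : Z.key = M.map fun i => L.getD i (0, 0) := by
    rw [key_eq_quad, hM]
    simp only [Multiset.insert_eq_cons, Multiset.map_cons, Multiset.map_singleton, hget]
  have hlt : ∀ i ∈ M, i < L.length := fun i hi => by
    simp only [hM, Multiset.insert_eq_cons, Multiset.mem_cons, Multiset.mem_singleton] at hi
    rcases hi with rfl | rfl | rfl | rfl <;> exact ha _
  have hsM : ((M.sort : List ℕ) : Multiset ℕ) = M := Multiset.sort_eq M _
  have hsorted := Multiset.pairwise_sort M (· ≤ ·)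
  have hlen : (M.sort).length = 4 := by rw [Multiset.length_sort]; simp [hM]
  generalize hs : M.sort = s at hsM hsorted hlen
  rcases s with _ | ⟨i, _ | ⟨j, _ | ⟨k, _ | ⟨l, _ | ⟨m, t⟩⟩⟩⟩⟩ <;> simp at hlen
  have hp1 := List.pairwise_cons.1 hsorted
  have hp2 := List.pairwise_cons.1 hp1.2
  have hp3 := List.pairwise_cons.1 hp2.2
  have hij : i ≤ j := hp1.1 j (by simp)
  have hjk : j ≤ k := hp2.1 k (by simp)
  have hkl : k ≤ l := hp3.1 l (by simp)
  have hmem : ∀ x, x ∈ [i, j, k, l] → x < L.length := fun x hx => hlt x (by rw [← hsM]; exact Multiset.mem_coe.2 hx)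
  rw [hkey, ← hsM]
  simp only [keysOver, List.mem_flatMap, List.mem_range]
  refine ⟨i, hmem i (by simp), j, hmem j (by simp), k, hmem k (by simp), l, hmem l (by simp), ?_⟩
  rw [if_pos ⟨hij, hjk, hkl⟩, List.mem_singleton]
  rfl

/-- a cell whose letters lie in an alphabet with coordinates `≤ B` is `B`-bounded. -/
theorem coordBounded_of_letters {L : List (ℕ × ℕ)} {B : ℕ} (hL : ∀ x ∈ L, x.1 ≤ B) {Z : Cell} (h : ∀ f, nl Z f ∈ L) :
    CoordBounded B Z := fun f s => by
  have h1 := hL _ (h f)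
  rw [nl_eq_nrm Z f s] at h1
  exact le_trans (le_max_left _ _) h1

/-- decoding the survivors: if every universe shape whose code survives is listed in `M`, a cell of the universe whose code survives
has its shape in `M`. (The hypothesis is checked per instance by `decide`.) -/
theorem key_mem_of_code {U M : List (Multiset (ℕ × ℕ))} {S : List ℕ} (hdec : ∀ K ∈ U, kenc K ∈ S → K ∈ M) {Z : Cell}
    (hU : Z.key ∈ U) (hS : kenc Z.key ∈ S) : Z.key ∈ M := hdec _ hU hS

end Summit.Ventures.HSemireg.Pad4Tower
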